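import Summits.QuantumFields.YangMills.Theorems.BalabanUVNodesN15TwoSpacingGluingEntries
import HarnessLib

/-!
# THE GLUING STEP AT TWO LATTICE SPACINGS, VII: the ADJOINT parametrix identity `G₀Δ_a = 1 − R̃` from cubes (`R̃ = Σ_□ M_{h_□}G_□[Δ_a, M_{h_□}]`, (2.91) transposed) for FILE 44's
# right-factor arrangement, and the letters of the adjoint commutator pieces `G_□∘[Δ_a, M_h]` for a Laplacian-type `Δ_a` from the cubes' RIGHT entries `G_□`, `G_□∘∇^±`
# (dag-n15-c g11, FILE 49; N15 = NE2, s1 «background-layer OPERATOR ingredient»)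

Cell `pub-ymgap`, seat `pub-ymgap-dag-n15-c` (R134 (a); HUMAN RULING D-0062), generation 11.  `bears_on: R4∕N15 · K3⁷ SpineGivenEndpointR13SepCoPH (stmt-QuantumFields-20544)`.
Filed `--supports stmt-QuantumFields-20544 --as helper` — COUNT-NEUTRAL.  One plumbing `def` (`remainderL`), the rest theorems; 0 `sorry`.  Imports BY NAME FILE 48 `…N15TwoSpacingGluingEntries`
(through it FILES 43–46: `parametrix`, `commOp`, `lapOp`, `glueInvL`, `commOp_lapDir`, `hasMaj_comp_diag`, `hasMaj_sum_overlap`, `idef_fsum`, `fgrad_comp_mulOp`∕`bgrad_comp_mulOp`; g8 FILE 1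
`mulOp_comp_fgrad`; lit `T4EtaRateCoeffDefect.hasMaj_mulOp`∕`hasMaj_idef_mulOp`, `B6Prop26Gluing.mulOp`∕`ind`); nothing in the tree is modified.

WHY.  FILE 44's entry-2 arrangement `G∘E = Ñ∘(G₀∘E)` (`E = ∇*`) resums the LEFT parametrix pair `G₀Δ_a = 1 − R̃`; FILE 45 derived the right pair `Δ_aG₀ = 1 − R` from cubes.  Block
majorants (`B11SectG.HasMaj`, sup sizes) are not transpose-invariant, so the adjoint pair is typed on its own: §1 def `remainderL Δ h G := Σ_□ M_{h_□}∘G_□∘commOp Δ h_□`, `cube_comp_lap`, ★★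
`parametrix_comp_lap` (`G₀∘Δ_a = 1 − R̃` from (2.36) and the RIGHT per-cube locality `G_□∘Δ_a∘M_{h_□} = M_{h_□}` — FILE 47's `cubeInv_comp_compress` shape), ★ `glued_adjoint_inverse` (FILE 44's
`glueInvL (remainderL …) (parametrix …)` inverts `Δ_a` on both sides); §2 ★ `hasMaj_remainderL`, ★★ `hasMaj_idef_remainderL` (letters of `R̃` from displayed letters of the adjoint pieces
`G_□∘[Δ_a, M_{h_□}] ≤ 1_S1_S·θ₀e^{−δd}` and their two-grid defects + partition fits); §3 `mulOp_comp_bgrad`, ★ `comp_commOp_lapOp` (`G∘[Δ_a, M_h] = Σ_μ[G∘M_{Δ_μh} − (G∘∇_μ)∘M_{(∇_μh)∘e⁻¹} +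
G∘M_{(∇_μ∇_μh)∘e⁻¹} − (G∘∇⁻_μ)∘M_{(∇⁻_μh)∘e} + G∘M_{(∇⁻_μ(∇⁻_μh∘e))}] + G∘[W, M_h]` — only the cube's RIGHT entries `G`, `G∘∇^±` appear), `hasMaj_comp_mulOp_loc`, ★★ `hasMaj_comp_commOp_lapOp` (the
adjoint (2.134) letter from right entries + the partition's smoothness + the `W`-letter).

HONEST FRAMING ∕ LIMITS.  Lattice Leibniz + bookkeeping ([B6] (2.36), (2.91)–(2.92), (2.133)–(2.135) = MECHANISM; nothing of [B6]∕[B9] asserted).  DISPLAYED: the cubes' right entries and the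
right per-cube locality (FILE 47's `cubeInv_comp_compress` for Dirichlet cubes), the `W`-part's adjoint commutator letter, the partition's letters; the η-defect of the adjoint (2.134) piece from
right-entry defects is the verbatim mirror of FILE 46 §3 — left to the socket file.  NE2⁺ NOT PRINTED, NOT proved; N15 NOT discharged; counts of record UNMOVED (typed 28∕28 · discharged 5∕27); one
finite 𝕋⁴ at fixed ε — NOT infinite volume, NOT OS on ℝ⁴, NOT a mass gap, NOT Clay; R4 closes the conditional finite-𝕋⁴ rung `BalabanLadder.UV` only.  Restate-immune (no Theses import).
-/

noncomputable section

namespace Summit.QuantumFields.YangMills.BalabanUVNodes.N15.Gluing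

open Literature.MathematicalPhysics.QuantumFieldTheory.Balaban1983to89
open Literature.MathematicalPhysics.QuantumFieldTheory.Balaban1983to89.B11SectG (BlockNorm HasMaj)
open Literature.MathematicalPhysics.QuantumFieldTheory.Balaban1983to89.T4EtaRateDefect (idef idef_apply idef_comp idef_add)
open Literature.MathematicalPhysics.QuantumFieldTheory.Balaban1983to89.T4EtaRateCoeffDefect (pull pull_apply diagK diagK_nonneg hasMaj_mulOp hasMaj_idef_mulOp)
open Literature.MathematicalPhysics.QuantumFieldTheory.Balaban1983to89.B6Prop26Gluing (mulOp mulOp_apply ind ind_nonneg ind_le_one)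
open Summit.QuantumFields.YangMills.BalabanUVNodes.N15.BackgroundLayer (fgrad fgradAdj bgrad fgrad_apply fgradAdj_apply bgrad_apply mulOp_comp_fgrad)

/-! ## §1 The adjoint parametrix identity from cubes -/

section Pair

variable {X : Type} {ι : Type} [Fintype ι]

/-- **THE ADJOINT REMAINDER** `R̃ = Σ_□ M_{h_□}∘G_□∘[Δ_a, M_{h_□}]` (the transposed arrangement of (2.91)–(2.92)). [cite: Balaban1984PropagatorsII, (2.91)–(2.92) p.239 (shape, transposed)] -/
def remainderL (Δ : (X → ℝ) →ₗ[ℝ] (X → ℝ)) (h : ι → X → ℝ) (G : ι → (X → ℝ) →ₗ[ℝ] (X → ℝ)) : (X → ℝ) →ₗ[ℝ] (X → ℝ) :=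
  ∑ i, mulOp (h i) ∘ₗ G i ∘ₗ commOp Δ (h i)

/-- ONE CUBE, adjoint side: `(M_hG_□M_h)∘Δ = M_h∘M_h − M_h∘G_□∘[Δ, M_h]` whenever `G_□∘Δ∘M_h = M_h`. [cite: Balaban1984PropagatorsII, (2.91) p.239 (mechanism, transposed)] -/
theorem cube_comp_lap {Δ G : (X → ℝ) →ₗ[ℝ] (X → ℝ)} {a : X → ℝ} (hloc : G ∘ₗ Δ ∘ₗ mulOp a = mulOp a) :
    (mulOp a ∘ₗ G ∘ₗ mulOp a) ∘ₗ Δ = mulOp a ∘ₗ mulOp a - mulOp a ∘ₗ G ∘ₗ commOp Δ a := by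
  have h1 : mulOp a ∘ₗ Δ = Δ ∘ₗ mulOp a - commOp Δ a := by rw [commOp]; abel
  calc (mulOp a ∘ₗ G ∘ₗ mulOp a) ∘ₗ Δ = mulOp a ∘ₗ G ∘ₗ (mulOp a ∘ₗ Δ) := by simp only [LinearMap.comp_assoc]
    _ = mulOp a ∘ₗ (G ∘ₗ Δ ∘ₗ mulOp a) - mulOp a ∘ₗ G ∘ₗ commOp Δ a := by rw [h1, LinearMap.comp_sub, LinearMap.comp_sub]
    _ = mulOp a ∘ₗ mulOp a - mulOp a ∘ₗ G ∘ₗ commOp Δ a := by rw [hloc]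

/-- ★★ **(2.91) TRANSPOSED, DERIVED**: `G₀∘Δ_a = 1 − R̃` from (2.36) and the right per-cube locality `G_□∘Δ_a∘M_{h_□} = M_{h_□}`. [cite: Balaban1984PropagatorsII, (2.91) p.239, (2.36) p.229] -/
theorem parametrix_comp_lap {Δ : (X → ℝ) →ₗ[ℝ] (X → ℝ)} {h : ι → X → ℝ} {G : ι → (X → ℝ) →ₗ[ℝ] (X → ℝ)} (h236 : ∀ x, ∑ i, h i x ^ 2 = 1)
    (hloc : ∀ i, G i ∘ₗ Δ ∘ₗ mulOp (h i) = mulOp (h i)) :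
    parametrix h G ∘ₗ Δ = LinearMap.id - remainderL Δ h G := by
  have hsum : parametrix h G ∘ₗ Δ = ∑ i, (mulOp (h i) ∘ₗ G i ∘ₗ mulOp (h i)) ∘ₗ Δ :=
    LinearMap.ext fun v => by simp only [parametrix, LinearMap.comp_apply, LinearMap.coe_sum, Finset.sum_apply]
  rw [hsum, remainderL, ← sum_mulOp_sq h h236, ← Finset.sum_sub_distrib]
  exact Finset.sum_congr rfl fun i _ => cube_comp_lap (hloc i)

/-- ★ **THE ADJOINT GLUED OPERATOR IS THE INVERSE OF `Δ_a`** (both sides): FILE 44's `glueInvL (remainderL Δ h G) (parametrix h G)`. [cite: Balaban1984PropagatorsII, (2.91) p.239 + p.247 (mechanism)] -/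
theorem glued_adjoint_inverse [Fintype X] [DecidableEq X] {Δ : (X → ℝ) →ₗ[ℝ] (X → ℝ)} {h : ι → X → ℝ} {G : ι → (X → ℝ) →ₗ[ℝ] (X → ℝ)} (h236 : ∀ x, ∑ i, h i x ^ 2 = 1)
    (hloc : ∀ i, G i ∘ₗ Δ ∘ₗ mulOp (h i) = mulOp (h i)) (hunit : IsUnit (1 - LinearMap.toMatrix' (remainderL Δ h G))) :
    glueInvL (remainderL Δ h G) (parametrix h G) ∘ₗ Δ = LinearMap.id ∧ Δ ∘ₗ glueInvL (remainderL Δ h G) (parametrix h G) = LinearMap.id :=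
  ⟨glueInvL_comp_lap hunit (parametrix_comp_lap h236 hloc), lap_comp_glueInvL hunit (parametrix_comp_lap h236 hloc)⟩

end Pair

/-! ## §2 Letters of the adjoint remainder from the adjoint pieces' letters -/

section Letters

variable {X X' : Type} [Fintype X] [Fintype X'] {ι : Type} [Fintype ι] {g : B6.Geometry} (blk : X → g.Site) (π : X' → X) (S : ι → Set g.Site)

/-- ★ **THE ADJOINT REMAINDER IS SMALL**: `G_□∘[Δ_a, M_{h_□}] ≤ 1_S1_S·θ₀e^{−δd}`, `|h_□| ≤ 1`, overlap `≤ N_ov` ⟹ `R̃ ≤ N_ov θ₀ e^{−δd}`. [cite: Balaban1984PropagatorsII, (2.134)–(2.135) p.247 (shape, transposed)] -/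
theorem hasMaj_remainderL {Δ : (X → ℝ) →ₗ[ℝ] (X → ℝ)} {h : ι → X → ℝ} {G : ι → (X → ℝ) →ₗ[ℝ] (X → ℝ)} {θ₀ δ Nov : ℝ} (hθ : 0 ≤ θ₀) (hh : ∀ i x, |h i x| ≤ 1)
    (hN : ∀ a, ∑ i, ind (S i) a ≤ Nov)
    (hKc : ∀ i, HasMaj (BlockNorm.ofBlocks g blk) (BlockNorm.ofBlocks g blk) (G i ∘ₗ commOp Δ (h i))
      (fun y y' => ind (S i) y * ind (S i) y' * (θ₀ * Real.exp (-(δ * g.dist y y'))))) :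
    HasMaj (BlockNorm.ofBlocks g blk) (BlockNorm.ofBlocks g blk) (remainderL Δ h G) (fun y y' => Nov * θ₀ * Real.exp (-(δ * g.dist y y'))) := by
  have hterm : ∀ i, HasMaj (BlockNorm.ofBlocks g blk) (BlockNorm.ofBlocks g blk) (mulOp (h i) ∘ₗ (G i ∘ₗ commOp Δ (h i)))
      (fun y y' => ind (S i) y * (θ₀ * Real.exp (-(δ * g.dist y y')))) := fun i => by
    have hMa := hasMaj_mulOp (g := g) blk (m := fun _ => (1 : ℝ)) (fun _ => zero_le_one) (hh i)
    refine (hasMaj_diag_comp blk (fun _ => zero_le_one) hMa (hKc i)).mono fun y y' => ?_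
    have key := ind_mul_ind_le (Sc := S i) (A := θ₀ * Real.exp (-(δ * g.dist y y'))) (mul_nonneg hθ (Real.exp_nonneg _)) y y'
    calc (1 : ℝ) * (ind (S i) y * ind (S i) y' * (θ₀ * Real.exp (-(δ * g.dist y y')))) = ind (S i) y * ind (S i) y' * (θ₀ * Real.exp (-(δ * g.dist y y'))) := one_mul _
      _ ≤ _ := key
  have hsum := hasMaj_sum_overlap _ S _ Nov (fun y y' => mul_nonneg hθ (Real.exp_nonneg _)) hterm hN
  rw [remainderL]
  refine (hsum.congr fun μ => ?_).mono fun y y' => le_of_eq (by ring)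
  simp only [LinearMap.coe_sum, Finset.sum_apply, LinearMap.comp_apply]

/-- ★★ **THE η-DEFECT OF THE ADJOINT REMAINDER** from the adjoint pieces' letters (fine `θ₀`), their two-grid defects `r`, and the partition's fits `o` (fine cut-off `|h′| ≤ 1`):
`𝔇(R̃′, R̃) ≤ N_ov(o·θ₀… ) ` — precisely `≤ N_ov(r + oθ₀)e^{−δd}`. [cite: Balaban1984PropagatorsII, (2.134)–(2.135) p.247 (shapes); Balaban1985BackgroundPropagators, Thm 3.14 pp.426–427 (template)] -/
theorem hasMaj_idef_remainderL {Δ : (X → ℝ) →ₗ[ℝ] (X → ℝ)} {Δ' : (X' → ℝ) →ₗ[ℝ] (X' → ℝ)} {h : ι → X → ℝ} {h' : ι → X' → ℝ} {G : ι → (X → ℝ) →ₗ[ℝ] (X → ℝ)}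
    {G' : ι → (X' → ℝ) →ₗ[ℝ] (X' → ℝ)} {θ₀ r o δ Nov : ℝ} (hθ : 0 ≤ θ₀) (hr : 0 ≤ r) (ho : 0 ≤ o) (hh' : ∀ i x', |h' i x'| ≤ 1) (hfit : ∀ i x', |h' i x' - h i (π x')| ≤ o)
    (hN : ∀ a, ∑ i, ind (S i) a ≤ Nov)
    (hKc : ∀ i, HasMaj (BlockNorm.ofBlocks g blk) (BlockNorm.ofBlocks g blk) (G i ∘ₗ commOp Δ (h i))
      (fun y y' => ind (S i) y * ind (S i) y' * (θ₀ * Real.exp (-(δ * g.dist y y')))))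
    (hDK : ∀ i, HasMaj (BlockNorm.ofBlocks g blk) (BlockNorm.ofBlocks g (blk ∘ π)) (idef (pull π) (pull π) (G' i ∘ₗ commOp Δ' (h' i)) (G i ∘ₗ commOp Δ (h i)))
      (fun y y' => ind (S i) y * ind (S i) y' * (r * Real.exp (-(δ * g.dist y y'))))) :
    HasMaj (BlockNorm.ofBlocks g blk) (BlockNorm.ofBlocks g (blk ∘ π)) (idef (pull π) (pull π) (remainderL Δ' h' G') (remainderL Δ h G))
      (fun y y' => Nov * (1 * r + o * θ₀) * Real.exp (-(δ * g.dist y y'))) := by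
  have hterm : ∀ i, HasMaj (BlockNorm.ofBlocks g blk) (BlockNorm.ofBlocks g (blk ∘ π))
      (idef (pull π) (pull π) (mulOp (h' i) ∘ₗ (G' i ∘ₗ commOp Δ' (h' i))) (mulOp (h i) ∘ₗ (G i ∘ₗ commOp Δ (h i))))
      (fun y y' => ind (S i) y * ((1 * r + o * θ₀) * Real.exp (-(δ * g.dist y y')))) := fun i => by
    have hMa' := hasMaj_mulOp (g := g) (blk ∘ π) (m := fun _ => (1 : ℝ)) (fun _ => zero_le_one) (hh' i)
    have hDM := hasMaj_idef_mulOp (g := g) blk π (o := fun _ => o) (fun _ => ho) (fun x' => hfit i x')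
    have t1 := hasMaj_diag_comp (blk ∘ π) (fun _ => zero_le_one) hMa' (hDK i)
    have t2 := hasMaj_diag_comp blk (fun _ => ho) hDM (hKc i)
    rw [idef_comp (pull π) (pull π) (pull π)]
    refine (t1.add t2).mono fun y y' => ?_
    have key := ind_mul_ind_le (Sc := S i) (A := (1 * r + o * θ₀) * Real.exp (-(δ * g.dist y y'))) (mul_nonneg (by positivity) (Real.exp_nonneg _)) y y'
    calc 1 * (ind (S i) y * ind (S i) y' * (r * Real.exp (-(δ * g.dist y y')))) + o * (ind (S i) y * ind (S i) y' * (θ₀ * Real.exp (-(δ * g.dist y y'))))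
        = ind (S i) y * ind (S i) y' * ((1 * r + o * θ₀) * Real.exp (-(δ * g.dist y y'))) := by ring
      _ ≤ _ := key
  rw [remainderL, remainderL, idef_fsum]
  refine (hasMaj_sum_overlap _ S _ Nov (fun y y' => mul_nonneg (by positivity) (Real.exp_nonneg _)) hterm hN).mono fun y y' => le_of_eq ?_
  ring

end Letters

/-! ## §3 The adjoint commutator piece for a Laplacian-type `Δ_a` from the cube's RIGHT entries -/

section Adjoint

variable {X : Type} [Fintype X] {J : Type} [Fintype J] {g : B6.Geometry} (blk : X → g.Site)

omit [Fintype X] [Fintype J] in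
/-- `M_a∘∇⁻ = ∇⁻∘M_{a∘e} − M_{∇⁻(a∘e)}` (moving a coefficient to the right of a backward quotient). [folklore] -/
theorem mulOp_comp_bgrad (n : ℝ) (e : X ≃ X) (a : X → ℝ) : mulOp a ∘ₗ bgrad n e = bgrad n e ∘ₗ mulOp (a ∘ e) - mulOp (bgrad n e (a ∘ e)) := by
  refine LinearMap.ext fun f => funext fun x => ?_
  simp only [LinearMap.comp_apply, LinearMap.sub_apply, Pi.sub_apply, bgrad_apply, mulOp_apply, Function.comp_apply, Equiv.apply_symm_apply]
  ring

omit [Fintype X] in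
/-- ★ **THE ADJOINT COMMUTATOR PIECE, Laplacian-type `Δ_a`**: `G∘[Δ_a, M_h] = Σ_μ [G∘M_{∇*∇h} − (G∘∇_μ)∘M_{(∇_μh)∘e⁻¹} + G∘M_{(∇_μ∇_μh)∘e⁻¹} − (G∘∇⁻_μ)∘M_{(∇⁻_μh)∘e} + G∘M_{∇⁻_μ((∇⁻_μh)∘e)}] + G∘[W, M_h]` —
only the cube's RIGHT entries `G`, `G∘∇_μ`, `G∘∇⁻_μ` and the `W`-part appear. [cite: Balaban1984PropagatorsII, (2.91)–(2.92) p.239 (mechanism, transposed)] -/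
theorem comp_commOp_lapOp (n : ℝ) (e : J → X ≃ X) (W G : (X → ℝ) →ₗ[ℝ] (X → ℝ)) (h : X → ℝ) :
    G ∘ₗ commOp (lapOp n e W) h =
      (∑ μ, (G ∘ₗ mulOp (fgradAdj n (e μ) (fgrad n (e μ) h)) -
        ((G ∘ₗ fgrad n (e μ)) ∘ₗ mulOp (fgrad n (e μ) h ∘ ⇑(e μ).symm) - G ∘ₗ mulOp (fgrad n (e μ) (fgrad n (e μ) h) ∘ ⇑(e μ).symm)) -
        ((G ∘ₗ bgrad n (e μ)) ∘ₗ mulOp (bgrad n (e μ) h ∘ ⇑(e μ)) - G ∘ₗ mulOp (bgrad n (e μ) (bgrad n (e μ) h ∘ ⇑(e μ)))))) +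
        G ∘ₗ commOp W h := by
  rw [lapOp, commOp_add_left, commOp_fsum_left, LinearMap.comp_add]
  congr 1
  have hsum : G ∘ₗ (∑ μ, commOp (lapDir n (e μ)) h) = ∑ μ, G ∘ₗ commOp (lapDir n (e μ)) h :=
    LinearMap.ext fun v => by simp only [LinearMap.comp_apply, LinearMap.coe_sum, Finset.sum_apply, map_sum]
  rw [hsum]
  refine Finset.sum_congr rfl fun μ _ => ?_
  rw [commOp_lapDir, LinearMap.comp_sub, LinearMap.comp_sub, mulOp_comp_fgrad, LinearMap.comp_sub, mulOp_comp_bgrad, LinearMap.comp_sub]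
  simp only [← LinearMap.comp_assoc]

/-- One term `T∘M_a` with `T ≤ 1_S1_S·βe^{−δd}` and `|a| ≤ c`: `≤ 1_S1_S·βc·e^{−δd}`. [folklore] -/
theorem hasMaj_comp_mulOp_loc {a : X → ℝ} {T : (X → ℝ) →ₗ[ℝ] (X → ℝ)} {S : Set g.Site} {c β δ : ℝ} (hβ : 0 ≤ β) (hc : 0 ≤ c) (ha : ∀ x, |a x| ≤ c)
    (hT : HasMaj (BlockNorm.ofBlocks g blk) (BlockNorm.ofBlocks g blk) T (fun y y' => ind S y * ind S y' * (β * Real.exp (-(δ * g.dist y y'))))) :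
    HasMaj (BlockNorm.ofBlocks g blk) (BlockNorm.ofBlocks g blk) (T ∘ₗ mulOp a) (fun y y' => ind S y * ind S y' * (β * c * Real.exp (-(δ * g.dist y y')))) := by
  have hnn : ∀ y y' : g.Site, 0 ≤ ind S y * ind S y' * (β * Real.exp (-(δ * g.dist y y'))) :=
    fun y y' => mul_nonneg (mul_nonneg (ind_nonneg _ _) (ind_nonneg _ _)) (mul_nonneg hβ (Real.exp_nonneg _))
  refine (hasMaj_comp_diag blk hnn hT (hasMaj_mulOp (g := g) blk (m := fun _ => c) (fun _ => hc) ha)).mono fun y y' => le_of_eq ?_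
  ring

omit [Fintype X] [Fintype J] in
/-- Shift-invariance of a sup bound: `|a| ≤ c` ⟹ `|a ∘ s| ≤ c`. [folklore] -/
theorem abs_comp_le {a : X → ℝ} {c : ℝ} (s : X → X) (ha : ∀ x, |a x| ≤ c) (x : X) : |(a ∘ s) x| ≤ c := ha (s x)

/-- ★★ **THE ADJOINT (2.134) LETTER FROM CUBE RIGHT ENTRIES**: `G ≤ 1_S1_S·βe^{−δd}`, `G∘∇_μ, G∘∇⁻_μ ≤ 1_S1_S·β₁e^{−δd}`, the partition's `|∇^±_μh| ≤ c₁` and second differences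
`|∇*∇h|, |∇∇h|, |∇⁻(∇⁻h∘e)| ≤ c₂`, the `W`-letter `G∘[W, M_h] ≤ 1_S1_S·θ_We^{−δd}` ⟹ `G∘[Δ_a, M_h] ≤ 1_S1_S·(|J|(3βc₂ + 2β₁c₁) + θ_W)·e^{−δd}`. [cite: Balaban1984PropagatorsII, (2.133)–(2.134) p.247 (shapes + mechanism, transposed)] -/
theorem hasMaj_comp_commOp_lapOp {n : ℝ} {e : J → X ≃ X} {W G : (X → ℝ) →ₗ[ℝ] (X → ℝ)} {h : X → ℝ} {S : Set g.Site} {β β₁ c₁ c₂ θW δ : ℝ}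
    (hβ : 0 ≤ β) (hβ₁ : 0 ≤ β₁) (hc₁ : 0 ≤ c₁) (hc₂ : 0 ≤ c₂)
    (hh1 : ∀ μ x, |fgrad n (e μ) h x| ≤ c₁) (hh1b : ∀ μ x, |bgrad n (e μ) h x| ≤ c₁) (hh2 : ∀ μ x, |fgradAdj n (e μ) (fgrad n (e μ) h) x| ≤ c₂)
    (hh2f : ∀ μ x, |fgrad n (e μ) (fgrad n (e μ) h) x| ≤ c₂) (hh2b : ∀ μ x, |bgrad n (e μ) (bgrad n (e μ) h ∘ ⇑(e μ)) x| ≤ c₂)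
    (hG : HasMaj (BlockNorm.ofBlocks g blk) (BlockNorm.ofBlocks g blk) G (fun y y' => ind S y * ind S y' * (β * Real.exp (-(δ * g.dist y y')))))
    (hD : ∀ μ, HasMaj (BlockNorm.ofBlocks g blk) (BlockNorm.ofBlocks g blk) (G ∘ₗ fgrad n (e μ)) (fun y y' => ind S y * ind S y' * (β₁ * Real.exp (-(δ * g.dist y y')))))
    (hDb : ∀ μ, HasMaj (BlockNorm.ofBlocks g blk) (BlockNorm.ofBlocks g blk) (G ∘ₗ bgrad n (e μ)) (fun y y' => ind S y * ind S y' * (β₁ * Real.exp (-(δ * g.dist y y')))))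
    (hW : HasMaj (BlockNorm.ofBlocks g blk) (BlockNorm.ofBlocks g blk) (G ∘ₗ commOp W h) (fun y y' => ind S y * ind S y' * (θW * Real.exp (-(δ * g.dist y y'))))) :
    HasMaj (BlockNorm.ofBlocks g blk) (BlockNorm.ofBlocks g blk) (G ∘ₗ commOp (lapOp n e W) h)
      (fun y y' => ind S y * ind S y' * ((Fintype.card J * (3 * (β * c₂) + 2 * (β₁ * c₁)) + θW) * Real.exp (-(δ * g.dist y y')))) := by
  have hterm : ∀ μ, HasMaj (BlockNorm.ofBlocks g blk) (BlockNorm.ofBlocks g blk)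
      (G ∘ₗ mulOp (fgradAdj n (e μ) (fgrad n (e μ) h)) -
        ((G ∘ₗ fgrad n (e μ)) ∘ₗ mulOp (fgrad n (e μ) h ∘ ⇑(e μ).symm) - G ∘ₗ mulOp (fgrad n (e μ) (fgrad n (e μ) h) ∘ ⇑(e μ).symm)) -
        ((G ∘ₗ bgrad n (e μ)) ∘ₗ mulOp (bgrad n (e μ) h ∘ ⇑(e μ)) - G ∘ₗ mulOp (bgrad n (e μ) (bgrad n (e μ) h ∘ ⇑(e μ)))))
      (fun y y' => ind S y * ind S y' * ((3 * (β * c₂) + 2 * (β₁ * c₁)) * Real.exp (-(δ * g.dist y y')))) := fun μ => by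
    have t0 := hasMaj_comp_mulOp_loc blk hβ hc₂ (hh2 μ) hG
    have t1 := hasMaj_comp_mulOp_loc blk hβ₁ hc₁ (abs_comp_le (⇑(e μ).symm) (hh1 μ)) (hD μ)
    have t2 := hasMaj_comp_mulOp_loc blk hβ hc₂ (abs_comp_le (⇑(e μ).symm) (hh2f μ)) hG
    have t3 := hasMaj_comp_mulOp_loc blk hβ₁ hc₁ (abs_comp_le (⇑(e μ)) (hh1b μ)) (hDb μ)
    have t4 := hasMaj_comp_mulOp_loc blk hβ hc₂ (hh2b μ) hG
    refine ((t0.sub (t1.sub t2)).sub (t3.sub t4)).mono fun y y' => le_of_eq ?_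
    ring
  have hsum := hasMaj_fsum (b₁ := BlockNorm.ofBlocks g blk) (b₃ := BlockNorm.ofBlocks g blk) Finset.univ _ _ fun μ _ => hterm μ
  rw [comp_commOp_lapOp]
  refine (hsum.add hW).mono fun y y' => le_of_eq ?_
  simp only [Finset.sum_const, Finset.card_univ, nsmul_eq_mul]
  ring

end Adjoint

end Summit.QuantumFields.YangMills.BalabanUVNodes.N15.Gluing

end
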